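/-
Copyright (c) 2026. All rights reserved.
Released under Apache 2.0 license as described in the file LICENSE.
Authors: HodgeCM publication cell (pub-hodgecm), model-construction sub-cell, construction prover `mc-unitary-3`.
-/
import Literature.NumberTheory.Weil1964.AdelicMetaplecticReindex
import Literature.NumberTheory.Weil1964.AdelicMetaplecticGenerators
import HarnessLib

/-!
# Weil's `r_F` on `Sp(W)(F)` for an arbitrary index type, and on the subgroup of rational points of `Sp(W_𝔸)`

Weil [Weil1964, Chap. III n° 37 p. 188, n° 40 p. 190, n° 41 Thm 6 p. 193]: over a number field `F`, with `X = F^ι`,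
`W = X × X^*`, `ψ` the standard character of `𝔸_F/F`, every RATIONAL point `σ ∈ Sp(W)(F)` of `Sp(W_𝔸)` carries a
unique element `r_F(σ) = (σ, 𝐫_F(σ))` of the metaplectic group `Mp_ψ(W_𝔸)` whose operator fixes the theta
distribution `Θ(Φ) = Σ_{ξ ∈ X_F} Φ(ξ)`, and `σ ↦ r_F(σ)` is a homomorphism (Gelbart–Rogawski's `i : Sp(𝕎)(k) → Mp(𝕎)`,
[GelbartRogawski1991, §3.1 p. 454]).  `AdelicMetaplecticGenerators` §4 constructs it for the index type `Fin n`
(`ratSp`, `ratThetaLiftCont`: Θ-invariance is checked on Weil's generators `m(a)`, `u(b)`, `w`, whose Poisson /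
fundamental-domain bookkeeping is written over `Fin n`).  The symplectic spaces of the unitary dual pair
(`UnitaryGroupSymplecticCarriers`, `UnitaryGroupDualPairCarriers`) are indexed by `Fin N × Fin M`; this file removes the
seam ONCE, by transport of structure along a numbering `e : ι ≃ Fin n` through the reindexing isomorphism
`adelicMpContReindex F e T : Mp_ψ(W_T)ᶜᵒⁿᵗ ≃* Mp_ψ(W_{reindex e e T})ᶜᵒⁿᵗ` of `AdelicMetaplecticReindex` — no generator is
re-derived.

## What is here (sorry-free; no new Literature facts)

§1 REINDEXING SYMPLECTIC MATRICES — `spMatrixReindex e : Sp_{2ι}(K) →* Sp_{2ι′}(K)` (`reindex (e ⊕ e) (e ⊕ e)`;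
`reindex_sumCongr_J`), `spMatrixReindex_mapHom` (commutes with change of scalars), `isUnit_det_reindex`, and the ONE
compatibility `spReindex_transportSp : spReindex e T (transportSp T hT A) = transportSp (reindex e e T) _ (spMatrixReindex e A)`
(`darboux_reindexW`: the Darboux frame of `reindex e e T` is the reindexed Darboux frame of `T`).
§2 RATIONAL POINTS, ANY `ι` — `ratSpι F ι T hT : Sp_{2ι}(F) →* Sp(W_𝔸, polar β_T) := transportSp T hT ∘ mapHom ι_𝔸`
(`T : Matrix ι ι 𝔸_F` with `IsUnit T.det`, exactly the currency of `transportSp` /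
`UnitaryGroup.SpTransport.mem_range_transportSp_mapHom`; `ratSpι_fin : ratSpι F (Fin n) = ratSp F` by `rfl`),
`spReindex_ratSpι`, `ratSpι_injective`.
§3 `r_F`, ANY `ι` — `ratThetaLiftContι F ι T hT : Sp_{2ι}(F) →* adelicMpCont F ι T`
(`= adelicThetaLiftCont ∘ codRestrict`, liftability `ratSpι_mem_adelicLiftableCont` pulled back from `Fin (card ι)` by
`ratLiftVia` / `coe_ratLiftVia_mem_adelicMpTheta` / `proj_ratLiftVia`), with `proj_ratThetaLiftContι` (`π ∘ r_F = ratSpι`),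
`thetaDist_omega_ratThetaLiftContι` (`Θ(ω(r_F γ) Φ) = Θ(Φ)`), `coe_ratThetaLiftContι_mem_adelicMpTheta`, UNIQUENESS
`coe_ratThetaLiftContι_eq` (a Θ-fixing pair over `ratSpι γ` is `r_F γ`), independence of the numbering
`ratThetaLiftContι_eq_ratLiftVia`, `ratThetaLiftContι_fin` (agrees with `ratThetaLiftCont` on `Fin n`), the range form
`exists_thetaFixing_cont_of_mem_range` and `thetaFixing_unique`.
§4 `r_F` ON THE SUBGROUP OF RATIONAL POINTS — `ratSpιRangeEquiv : Sp_{2ι}(F) ≃* range (transportSp T hT ∘ mapHom ι_𝔸)`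
and **`ratPointsThetaLiftCont F ι T hT : range (transportSp T hT ∘ mapHom ι_𝔸) →* adelicMpCont F ι T`** with
`proj_ratPointsThetaLiftCont` (`π (r_F h) = h`), `coe_ratPointsThetaLiftCont_mem_adelicMpTheta`,
`thetaDist_omega_ratPointsThetaLiftCont`, `coe_ratPointsThetaLiftCont_eq` (uniqueness),
`ratPointsThetaLiftCont_ratSpιRangeEquiv` — the shape in which an `F`-RATIONAL ELEMENT `h₀ ∈ Sp(W_𝔸)` known through
`h₀ ∈ range (transportSp T ∘ mapHom ι_𝔸)` (e.g. the isometry element of a see-saw of unitary dual pairs,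
[GelbartRogawski1991, §3.1 p. 455]) is lifted to a Θ-fixing `r_F(h₀) ∈ Mp_ψ(W_𝔸)ᶜᵒⁿᵗ`, multiplicatively in `h₀`.

Consumers (publication cell, junction `E`, the `(34)`-side of the see-saw): with `T = T_V ⊗ 1 ⊗ₖ T_W ⊗ 1` on
`Fin N × Fin M` and `h₀ ⊗ 1 ∈ range (transportSp T ∘ mapHom ι_𝔸)` (group side), `r(h₀) := ratPointsThetaLiftCont … ⟨h₀ ⊗ 1, _⟩`
is Θ-fixing with `adelicMpCont.proj … (r h₀) = h₀ ⊗ 1`, and conjugation by `toOp (r h₀)` transports Θ-fixing splittings.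

## References
* [Weil1964] A. Weil, *Sur certains groupes d'opérateurs unitaires*, Acta Math. 111 (1964), Chap. III n° 37 p. 188
  (`Sp(X_k)` inside `Sp(X_A)`), n° 40 p. 190 (`r_k`), n° 41 Théorème 6 p. 193 (`Θ ∘ r_k(σ) = Θ`).
* [GelbartRogawski1991] S. Gelbart, J. Rogawski, *L-functions and Fourier–Jacobi coefficients for the unitary group
  U(3)*, Invent. Math. 105 (1991), §3.1 pp. 454–455 (`i : Sp(𝕎)(k) → Mp(𝕎)`, rational elements of a see-saw).
* [MoeglinVignerasWaldspurger1987] C. Mœglin, M.-F. Vignéras, J.-L. Waldspurger, *Correspondances de Howe sur un corps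
  p-adique*, LNM 1291, Chap. 2 II.1 (naturality of `Mp_ψ`), Chap. 1 I.17 (see-saw dual pairs).
-/

set_option autoImplicit false

noncomputable section

open NumberField
open scoped Matrix

namespace Literature.NumberTheory.Weil1964

open Literature.RepresentationTheory.HeisenbergGroup
open Literature.RepresentationTheory.HeisenbergGroup.SymplecticMatrix (transportSp mapHom coe_transportSp_apply coe_mapHom
  darboux darboux_apply darboux_symm_apply transportSp_injective)
open Literature.NumberTheory.Automorphic
open Literature.NumberTheory.Automorphic.UnitaryGroup (symplecticGroupCongr spReindex reindexW reindexW_apply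
  reindexW_symm_apply coe_spReindex_apply spReindex_injective)

/-! ## §1 Reindexing symplectic matrices along `e : ι ≃ ι′` -/

section MatrixReindex

variable {K : Type*} [CommRing K] {ι ι' : Type*} [Fintype ι] [Fintype ι'] [DecidableEq ι] [DecidableEq ι']
  (e : ι ≃ ι')

omit [Fintype ι] [Fintype ι'] in
/-- `J` is natural under reindexing both blocks: `reindex (e ⊕ e) (e ⊕ e) J_ι = J_{ι′}`. [folklore] -/
theorem reindex_sumCongr_J :
    Matrix.reindex (e.sumCongr e) (e.sumCongr e) (Matrix.J ι K) = Matrix.J ι' K := by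
  ext (i | i) (j | j) <;>
    simp [Matrix.J, Matrix.fromBlocks, Matrix.one_apply, Matrix.neg_apply]

/-- a reindexed symplectic matrix is symplectic. [folklore] -/
theorem reindex_mem_symplecticGroup (A : Matrix.symplecticGroup ι K) :
    Matrix.reindex (e.sumCongr e) (e.sumCongr e) (A : Matrix (ι ⊕ ι) (ι ⊕ ι) K) ∈ Matrix.symplecticGroup ι' K := by
  rw [SymplecticGroup.mem_iff, ← reindex_sumCongr_J e]
  simp only [Matrix.reindex_apply, Matrix.transpose_submatrix, Matrix.submatrix_mul_equiv,
    SymplecticGroup.mem_iff.1 A.2]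

/-- **`Sp_{2ι}(K) →* Sp_{2ι′}(K)`, `A ↦ reindex (e ⊕ e) (e ⊕ e) A`.** [folklore] -/
def spMatrixReindex : Matrix.symplecticGroup ι K →* Matrix.symplecticGroup ι' K where
  toFun A := ⟨Matrix.reindex (e.sumCongr e) (e.sumCongr e) (A : Matrix (ι ⊕ ι) (ι ⊕ ι) K),
    reindex_mem_symplecticGroup e A⟩
  map_one' := Subtype.ext <| by
    simp only [OneMemClass.coe_one, Matrix.reindex_apply, Matrix.submatrix_one_equiv]
  map_mul' A B := Subtype.ext <| by
    simp only [Submonoid.coe_mul, Matrix.reindex_apply, Matrix.submatrix_mul_equiv]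

/-- the matrix of `spMatrixReindex e A`. [folklore] -/
@[simp] theorem coe_spMatrixReindex (A : Matrix.symplecticGroup ι K) :
    ((spMatrixReindex e A : Matrix.symplecticGroup ι' K) : Matrix (ι' ⊕ ι') (ι' ⊕ ι') K) =
      Matrix.reindex (e.sumCongr e) (e.sumCongr e) (A : Matrix (ι ⊕ ι) (ι ⊕ ι) K) :=
  rfl

/-- reindexing commutes with change of scalars. [folklore] -/
theorem spMatrixReindex_mapHom {K' : Type*} [CommRing K'] (f : K →+* K') (A : Matrix.symplecticGroup ι K) :
    spMatrixReindex e (mapHom f A) = mapHom f (spMatrixReindex e A) :=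
  Subtype.ext rfl

variable (T : Matrix ι ι K) (hT : IsUnit T.det)

include hT in
/-- `det (reindex e e T)` is a unit when `det T` is. [folklore] -/
theorem isUnit_det_reindex : IsUnit (Matrix.reindex e e T).det := by
  rwa [Matrix.det_reindex_self]

/-- Darboux coordinates commute with reindexing: `P′ (e v) = (P v) ∘ (e ⊕ e)⁻¹`. [folklore] -/
theorem darboux_reindexW (v : (ι → K) × (ι → K)) :
    darboux (Matrix.reindex e e T) (isUnit_det_reindex e T hT) (reindexW K e v) =
      darboux T hT v ∘ (e.sumCongr e).symm := by
  funext i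
  rcases i with i | i
  · rfl
  · have hv : (v.2 ∘ ⇑e.symm) ∘ ⇑e.symm.symm = v.2 := funext fun j => by
      simp only [Function.comp_apply, Equiv.symm_symm, Equiv.symm_apply_apply]
    simp only [darboux_apply, reindexW_apply, Sum.elim_inr, Function.comp_apply, Equiv.sumCongr_symm,
      Equiv.sumCongr_apply, Sum.map_inr, Matrix.reindex_apply, Matrix.submatrix_mulVec_equiv, hv]

/-- … and so do their inverses: `P′⁻¹ (u ∘ (e ⊕ e)⁻¹) = e (P⁻¹ u)`. [folklore] -/
theorem darboux_symm_comp (u : ι ⊕ ι → K) :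
    (darboux (Matrix.reindex e e T) (isUnit_det_reindex e T hT)).symm (u ∘ (e.sumCongr e).symm) =
      reindexW K e ((darboux T hT).symm u) := by
  rw [LinearEquiv.symm_apply_eq, darboux_reindexW e T hT, LinearEquiv.apply_symm_apply]

/-- **Transport commutes with reindexing**: `spReindex e T (P⁻¹ A P) = P′⁻¹ (reindex A) P′`. [folklore] -/
theorem spReindex_transportSp (A : Matrix.symplecticGroup ι K) :
    spReindex e T (transportSp T hT A) =
      transportSp (Matrix.reindex e e T) (isUnit_det_reindex e T hT) (spMatrixReindex e A) := by
  apply Subtype.ext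
  refine LinearEquiv.ext fun v => ?_
  have hv : v = reindexW K e ((reindexW K e).symm v) := ((reindexW K e).apply_symm_apply v).symm
  rw [coe_spReindex_apply, coe_transportSp_apply, coe_transportSp_apply, coe_spMatrixReindex,
    ← darboux_symm_comp e T hT]
  congr 1
  conv_rhs => rw [hv, darboux_reindexW e T hT]
  have hw : ∀ w : ι ⊕ ι → K, (w ∘ ⇑(e.sumCongr e).symm) ∘ ⇑(e.sumCongr e).symm.symm = w := fun w =>
    funext fun j => by simp only [Function.comp_apply, Equiv.symm_symm, Equiv.symm_apply_apply]
  rw [Matrix.reindex_apply, Matrix.submatrix_mulVec_equiv, hw]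

end MatrixReindex

/-! ## §2 The rational symplectic group inside `Sp(W_𝔸)` for an arbitrary index type -/

section Rational

variable (F : Type) [Field F] [NumberField F] (ι : Type) [Fintype ι] [DecidableEq ι]
  (T : Matrix ι ι (AdeleRing (𝓞 F) F)) (hT : IsUnit T.det)

include hT in
/-- `y ↦ T y` is onto (hypothesis shape of `AdelicMetaplecticGroup`). [folklore] -/
theorem mulVec_surjective_of_isUnit_det' : Function.Surjective fun y : ι → AdeleRing (𝓞 F) F => T *ᵥ y :=
  mulVec_surjective_of_isUnit ((Matrix.isUnit_iff_isUnit_det T).2 hT)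

/-- **`Sp_{2ι}(F) → Sp_{2ι}(𝔸_F) → Sp(W_𝔸, polar β_T)`** for an arbitrary finite index type `ι`
(`mapHom ι_𝔸` then `transportSp T`; for `ι = Fin n` this is `ratSp` of `AdelicMetaplecticGenerators`).
[cite: Weil1964, Chap. III n° 37 p. 188] -/
def ratSpι : Matrix.symplecticGroup ι F →* symplecticGroup (polar (adelicForm F ι T)) :=
  (transportSp T hT).comp (mapHom (algebraMap F (AdeleRing (𝓞 F) F)))

/-- on `Fin n` the two agree. [folklore] -/
theorem ratSpι_fin {n : ℕ} (T : Matrix (Fin n) (Fin n) (AdeleRing (𝓞 F) F)) (hT : IsUnit T.det) :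
    ratSpι F (Fin n) T hT = ratSp F T hT := rfl

variable {ι' : Type} [Fintype ι'] [DecidableEq ι'] (e : ι ≃ ι')

/-- reindexing a rational point gives a rational point. [folklore] -/
theorem spReindex_ratSpι (γ : Matrix.symplecticGroup ι F) :
    spReindex e T (ratSpι F ι T hT γ) = ratSpι F ι' (Matrix.reindex e e T) (isUnit_det_reindex e T hT) (spMatrixReindex e γ) := by
  rw [ratSpι, ratSpι, MonoidHom.comp_apply, MonoidHom.comp_apply, spReindex_transportSp, spMatrixReindex_mapHom]

end Rational

/-! ## §3 Θ-liftability of the rational points (arbitrary `ι`), via `Fin (card ι)` and the reindexing of `Mp_ψ` -/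

section Lift

variable (F : Type) [Field F] [NumberField F] (ι : Type) [Fintype ι] [DecidableEq ι]
  (T : Matrix ι ι (AdeleRing (𝓞 F) F)) (hT : IsUnit T.det)

/-- **The lift through a numbering `e : ι ≃ Fin n`**: `(reindex_e)⁻¹ (r_F (reindex γ))`. [folklore] -/
def ratLiftVia {n : ℕ} (e : ι ≃ Fin n) (γ : Matrix.symplecticGroup ι F) : adelicMpCont F ι T :=
  (adelicMpContReindex F e T).symm
    (ratThetaLiftCont F (Matrix.reindex e e T) (isUnit_det_reindex e T hT) (spMatrixReindex e γ))

/-- it fixes `Θ`. [cite: Weil1964, Chap. III n° 41 Thm 6 p. 193] -/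
theorem coe_ratLiftVia_mem_adelicMpTheta {n : ℕ} (e : ι ≃ Fin n) (γ : Matrix.symplecticGroup ι F) :
    (ratLiftVia F ι T hT e γ : adelicMp F ι T) ∈ adelicMpTheta F ι T := by
  apply (coe_adelicMpContReindex_mem_adelicMpTheta_iff F e T (ratLiftVia F ι T hT e γ)).1
  have hR : adelicMpContReindex F e T (ratLiftVia F ι T hT e γ) =
      ratThetaLiftCont F _ (isUnit_det_reindex e T hT) (spMatrixReindex e γ) :=
    MulEquiv.apply_symm_apply _ _
  rw [hR]
  exact coe_ratThetaLiftCont_mem_adelicMpTheta F _ _ _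

/-- it lies over `ratSpι γ`. [cite: Weil1964, Chap. III n° 40 p. 190] -/
theorem proj_ratLiftVia {n : ℕ} (e : ι ≃ Fin n) (γ : Matrix.symplecticGroup ι F) :
    adelicMpCont.proj F ι T (ratLiftVia F ι T hT e γ) = ratSpι F ι T hT γ := by
  apply spReindex_injective e T
  have hR : adelicMpContReindex F e T (ratLiftVia F ι T hT e γ) =
      ratThetaLiftCont F _ (isUnit_det_reindex e T hT) (spMatrixReindex e γ) :=
    MulEquiv.apply_symm_apply _ _
  calc spReindex e T (adelicMpCont.proj F ι T (ratLiftVia F ι T hT e γ))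
      = adelicMpCont.proj F (Fin n) _ (adelicMpContReindex F e T (ratLiftVia F ι T hT e γ)) :=
        (adelicMpCont.proj_reindex F e T _).symm
    _ = adelicMpCont.proj F (Fin n) _
          (ratThetaLiftCont F _ (isUnit_det_reindex e T hT) (spMatrixReindex e γ)) :=
        congrArg (adelicMpCont.proj F (Fin n) (Matrix.reindex e e T)) hR
    _ = ratSp F _ (isUnit_det_reindex e T hT) (spMatrixReindex e γ) := proj_ratThetaLiftCont F _ _ _
    _ = spReindex e T (ratSpι F ι T hT γ) := (spReindex_ratSpι F ι T hT e γ).symm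

/-- **every rational point of `Sp(W_𝔸)` is Θ-liftable with LF-continuous lift** (arbitrary index type).
[cite: Weil1964, Chap. III n° 40 p. 190, n° 41 Thm 6 p. 193] -/
theorem ratSpι_mem_adelicLiftableCont (γ : Matrix.symplecticGroup ι F) :
    ∃ hg : ratSpι F ι T hT γ ∈ adelicLiftable F ι T,
      (⟨ratSpι F ι T hT γ, hg⟩ : adelicLiftable F ι T) ∈
        adelicLiftableCont T (mulVec_surjective_of_isUnit_det' F ι T hT) := by
  have h := mem_adelicLiftableCont_of_mem (mulVec_surjective_of_isUnit_det' F ι T hT)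
    (coe_ratLiftVia_mem_adelicMpTheta F ι T hT (Fintype.equivFin ι) γ) (ratLiftVia F ι T hT (Fintype.equivFin ι) γ).2
  have hp : MpPsi.proj _ (ratLiftVia F ι T hT (Fintype.equivFin ι) γ : adelicMp F ι T) = ratSpι F ι T hT γ := by
    rw [← adelicMpCont.proj_apply]; exact proj_ratLiftVia F ι T hT _ γ
  simp only [hp] at h
  exact ⟨_, h⟩

/-- `Sp_{2ι}(F) →* adelicLiftableCont` (`ratSpι` with refined target). [folklore] -/
def ratSpιLiftableCont :
    Matrix.symplecticGroup ι F →* adelicLiftableCont T (mulVec_surjective_of_isUnit_det' F ι T hT) :=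
  ((ratSpι F ι T hT).codRestrict (adelicLiftable F ι T) fun γ =>
      (ratSpι_mem_adelicLiftableCont F ι T hT γ).fst).codRestrict _ fun γ =>
    (ratSpι_mem_adelicLiftableCont F ι T hT γ).snd

/-- `ratSpιLiftableCont γ` is `ratSpι γ` in `Sp(W_𝔸)`. [folklore] -/
@[simp] theorem coe_coe_ratSpιLiftableCont (γ : Matrix.symplecticGroup ι F) :
    ((ratSpιLiftableCont F ι T hT γ : adelicLiftable F ι T) : symplecticGroup (polar (adelicForm F ι T))) =
      ratSpι F ι T hT γ := rfl

/-- **Weil's `r_F` / GR91's `i` on `Sp(W)(F)`, arbitrary index type**: `Sp_{2ι}(F) →* Mp_ψ(W_𝔸)ᶜᵒⁿᵗ`,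
`γ ↦` the unique Θ-fixing pair over `ratSpι γ`. [cite: Weil1964, Chap. III n° 40 p. 190, n° 41 Thm 6 p. 193] -/
def ratThetaLiftContι : Matrix.symplecticGroup ι F →* adelicMpCont F ι T :=
  (adelicThetaLiftCont T (mulVec_surjective_of_isUnit_det' F ι T hT)).comp (ratSpιLiftableCont F ι T hT)

/-- `π ∘ r_F = ratSpι`. [cite: Weil1964, Chap. III n° 40 p. 190] -/
@[simp] theorem proj_ratThetaLiftContι (γ : Matrix.symplecticGroup ι F) :
    adelicMpCont.proj F ι T (ratThetaLiftContι F ι T hT γ) = ratSpι F ι T hT γ :=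
  proj_adelicThetaLiftCont (mulVec_surjective_of_isUnit_det' F ι T hT) (ratSpιLiftableCont F ι T hT γ)

/-- `π(r_F(γ)) = ratSpι γ` in `Mp_ψ(W_𝔸)`. [cite: Weil1964, Chap. III n° 40 p. 190] -/
theorem proj_coe_ratThetaLiftContι (γ : Matrix.symplecticGroup ι F) :
    MpPsi.proj _ (ratThetaLiftContι F ι T hT γ : adelicMp F ι T) = ratSpι F ι T hT γ := by
  rw [← adelicMpCont.proj_apply, proj_ratThetaLiftContι]

/-- `Θ ∘ ω(r_F(γ)) = Θ`. [cite: Weil1964, Chap. III n° 41 Thm 6 p. 193] -/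
theorem thetaDist_omega_ratThetaLiftContι (γ : Matrix.symplecticGroup ι F) (Φ : piSchwartzBruhat F ι) :
    thetaDist F ι ((adelicMpCont.omega F ι T (ratThetaLiftContι F ι T hT γ) Φ : piSchwartzBruhat F ι) :
        (ι → AdeleRing (𝓞 F) F) → ℂ) = thetaDist F ι (Φ : (ι → AdeleRing (𝓞 F) F) → ℂ) :=
  thetaDist_omega_adelicThetaLiftCont _ _ Φ

/-- `r_F(γ)` fixes `Θ` (membership form). [cite: Weil1964, Chap. III n° 41 Thm 6 p. 193] -/
theorem coe_ratThetaLiftContι_mem_adelicMpTheta (γ : Matrix.symplecticGroup ι F) :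
    (ratThetaLiftContι F ι T hT γ : adelicMp F ι T) ∈ adelicMpTheta F ι T :=
  adelicThetaLift_mem T (mulVec_surjective_of_isUnit_det' F ι T hT) (ratSpιLiftableCont F ι T hT γ)

/-- **Uniqueness (Θ-rigidity)**: a Θ-fixing pair over `ratSpι γ` IS `r_F(γ)`. [cite: Weil1964, Chap. III n° 40 p. 190] -/
theorem coe_ratThetaLiftContι_eq {γ : Matrix.symplecticGroup ι F} {p : adelicMp F ι T}
    (hΘ : p ∈ adelicMpTheta F ι T) (hp : MpPsi.proj _ p = ratSpι F ι T hT γ) :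
    (ratThetaLiftContι F ι T hT γ : adelicMp F ι T) = p :=
  adelicMp_eq_of_proj_eq (mulVec_surjective_of_isUnit_det' F ι T hT) (coe_ratThetaLiftContι_mem_adelicMpTheta F ι T hT γ)
    hΘ ((proj_coe_ratThetaLiftContι F ι T hT γ).trans hp.symm)

/-- `r_F` computed through ANY numbering `e : ι ≃ Fin n`. [folklore] -/
theorem ratThetaLiftContι_eq_ratLiftVia {n : ℕ} (e : ι ≃ Fin n) (γ : Matrix.symplecticGroup ι F) :
    ratThetaLiftContι F ι T hT γ = ratLiftVia F ι T hT e γ :=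
  Subtype.ext <| coe_ratThetaLiftContι_eq F ι T hT (coe_ratLiftVia_mem_adelicMpTheta F ι T hT e γ)
    (by rw [← adelicMpCont.proj_apply, proj_ratLiftVia])

/-- on `Fin n`, `r_F` of this file is `ratThetaLiftCont` of `AdelicMetaplecticGenerators`. [folklore] -/
theorem ratThetaLiftContι_fin {n : ℕ} (T : Matrix (Fin n) (Fin n) (AdeleRing (𝓞 F) F)) (hT : IsUnit T.det)
    (γ : Matrix.symplecticGroup (Fin n) F) :
    ratThetaLiftContι F (Fin n) T hT γ = ratThetaLiftCont F T hT γ :=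
  Subtype.ext <| coe_ratThetaLiftContι_eq F (Fin n) T hT (coe_ratThetaLiftCont_mem_adelicMpTheta F T hT γ)
    (proj_coe_ratThetaLiftCont F T hT γ)

/-- **Range form (the consumer's input shape)**: every element of `Sp(W_𝔸)` in the range of
`transportSp T ∘ mapHom ι_𝔸` (a RATIONAL point, e.g. by `UnitaryGroup.SpTransport.mem_range_transportSp_mapHom`) has a
Θ-fixing pair in `Mp_ψ(W_𝔸)ᶜᵒⁿᵗ` over it, unique in `Mp_ψ(W_𝔸)`. [cite: Weil1964, Chap. III n° 41 Thm 6 p. 193] -/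
theorem exists_thetaFixing_cont_of_mem_range {g : symplecticGroup (polar (adelicForm F ι T))}
    (hg : g ∈ ((transportSp T hT).comp (mapHom (algebraMap F (AdeleRing (𝓞 F) F)))).range) :
    ∃ p : adelicMpCont F ι T, (p : adelicMp F ι T) ∈ adelicMpTheta F ι T ∧ adelicMpCont.proj F ι T p = g := by
  obtain ⟨γ, rfl⟩ := hg
  exact ⟨ratThetaLiftContι F ι T hT γ, coe_ratThetaLiftContι_mem_adelicMpTheta F ι T hT γ,
    proj_ratThetaLiftContι F ι T hT γ⟩

include hT in
/-- … and any two Θ-fixing pairs over the same element coincide. [cite: Weil1964, Chap. III n° 41 Thm 6 p. 193] -/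
theorem thetaFixing_unique {p q : adelicMpCont F ι T} (hp : (p : adelicMp F ι T) ∈ adelicMpTheta F ι T)
    (hq : (q : adelicMp F ι T) ∈ adelicMpTheta F ι T)
    (h : adelicMpCont.proj F ι T p = adelicMpCont.proj F ι T q) : p = q :=
  Subtype.ext <| adelicMp_eq_of_proj_eq (mulVec_surjective_of_isUnit_det' F ι T hT) hp hq h

end Lift

/-! ## §4 `r_F` as a homomorphism on the subgroup `Sp(W)(F) = range (transportSp T ∘ mapHom ι_𝔸)` of rational points -/

section RatPoints

variable (F : Type) [Field F] [NumberField F] (ι : Type) [Fintype ι] [DecidableEq ι]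
  (T : Matrix ι ι (AdeleRing (𝓞 F) F)) (hT : IsUnit T.det)

/-- change of scalars along an injective ring map is injective on `Sp_{2ι}`. [folklore] -/
theorem mapHom_injective_of_injective {K K' : Type*} [CommRing K] [CommRing K'] (f : K →+* K')
    (hf : Function.Injective f) : Function.Injective (mapHom (ι := ι) f) :=
  fun _ _ h => Subtype.ext (Matrix.map_injective hf (congrArg Subtype.val h))

/-- `ratSpι` is injective (`F ↪ 𝔸_F`, `transportSp` injective). [folklore] -/
theorem ratSpι_injective : Function.Injective (ratSpι F ι T hT) := by
  haveI : Nontrivial (AdeleRing (𝓞 F) F) :=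
    inferInstanceAs (Nontrivial (InfiniteAdeleRing F × IsDedekindDomain.FiniteAdeleRing (𝓞 F) F))
  exact (transportSp_injective T hT).comp
    (mapHom_injective_of_injective ι _ (algebraMap F (AdeleRing (𝓞 F) F)).injective)

/-- **`Sp_{2ι}(F) ≃* Sp(W)(F)`**, the latter as the range subgroup of `transportSp T ∘ mapHom ι_𝔸` in `Sp(W_𝔸)`.
[cite: Weil1964, Chap. III n° 37 p. 188] -/
def ratSpιRangeEquiv :
    Matrix.symplecticGroup ι F ≃* ((transportSp T hT).comp (mapHom (algebraMap F (AdeleRing (𝓞 F) F)))).range :=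
  MonoidHom.ofInjective (ratSpι_injective F ι T hT)

/-- `↑(ratSpιRangeEquiv γ) = ratSpι γ`. [folklore] -/
@[simp] theorem coe_ratSpιRangeEquiv (γ : Matrix.symplecticGroup ι F) :
    ((ratSpιRangeEquiv F ι T hT γ : ((transportSp T hT).comp (mapHom (algebraMap F (AdeleRing (𝓞 F) F)))).range) :
      symplecticGroup (polar (adelicForm F ι T))) = ratSpι F ι T hT γ :=
  rfl

/-- `ratSpι (ratSpιRangeEquiv⁻¹ h) = h`. [folklore] -/
@[simp] theorem ratSpι_ratSpιRangeEquiv_symm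
    (g : ((transportSp T hT).comp (mapHom (algebraMap F (AdeleRing (𝓞 F) F)))).range) :
    ratSpι F ι T hT ((ratSpιRangeEquiv F ι T hT).symm g) = (g : symplecticGroup (polar (adelicForm F ι T))) :=
  MonoidHom.apply_ofInjective_symm (ratSpι_injective F ι T hT) g

/-- **`Sp(W)(F)` is Θ-liftable with continuous lift** (pointwise form of `range ≤ liftable`).
[cite: Weil1964, Chap. III n° 40 p. 190, n° 41 Thm 6 p. 193] -/
theorem mem_range_adelicLiftableCont
    (g : ((transportSp T hT).comp (mapHom (algebraMap F (AdeleRing (𝓞 F) F)))).range) :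
    ∃ p : adelicMpCont F ι T, (p : adelicMp F ι T) ∈ adelicMpTheta F ι T ∧
      adelicMpCont.proj F ι T p = (g : symplecticGroup (polar (adelicForm F ι T))) :=
  exists_thetaFixing_cont_of_mem_range F ι T hT g.2

/-- **`r_F : Sp(W)(F) →* Mp_ψ(W_𝔸)ᶜᵒⁿᵗ` on the subgroup of rational points of `Sp(W_𝔸)`** (GR91's `i` on `Sp(𝕎)(k)`
as a homomorphism of the range subgroup — the shape in which an `F`-rational ELEMENT `h₀ ∈ Sp(W_𝔸)`, known only through
`h₀ ∈ range (transportSp T ∘ mapHom ι_𝔸)`, is lifted): `r_F ∘ (ratSpιRangeEquiv)⁻¹`. [cite: GelbartRogawski1991, §3.1 p. 454] -/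
def ratPointsThetaLiftCont :
    ((transportSp T hT).comp (mapHom (algebraMap F (AdeleRing (𝓞 F) F)))).range →* adelicMpCont F ι T :=
  (ratThetaLiftContι F ι T hT).comp (ratSpιRangeEquiv F ι T hT).symm.toMonoidHom

/-- unfolding. [folklore] -/
theorem ratPointsThetaLiftCont_apply
    (g : ((transportSp T hT).comp (mapHom (algebraMap F (AdeleRing (𝓞 F) F)))).range) :
    ratPointsThetaLiftCont F ι T hT g = ratThetaLiftContι F ι T hT ((ratSpιRangeEquiv F ι T hT).symm g) :=
  rfl

/-- on `ratSpι γ` it is `r_F(γ)`. [folklore] -/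
theorem ratPointsThetaLiftCont_ratSpιRangeEquiv (γ : Matrix.symplecticGroup ι F) :
    ratPointsThetaLiftCont F ι T hT (ratSpιRangeEquiv F ι T hT γ) = ratThetaLiftContι F ι T hT γ :=
  congrArg (ratThetaLiftContι F ι T hT) ((ratSpιRangeEquiv F ι T hT).symm_apply_apply γ)

/-- `π (r_F h) = h`. [cite: Weil1964, Chap. III n° 40 p. 190] -/
@[simp] theorem proj_ratPointsThetaLiftCont
    (g : ((transportSp T hT).comp (mapHom (algebraMap F (AdeleRing (𝓞 F) F)))).range) :
    adelicMpCont.proj F ι T (ratPointsThetaLiftCont F ι T hT g) = (g : symplecticGroup (polar (adelicForm F ι T))) :=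
  (proj_ratThetaLiftContι F ι T hT _).trans (ratSpι_ratSpιRangeEquiv_symm F ι T hT g)

/-- `r_F h` fixes `Θ`. [cite: Weil1964, Chap. III n° 41 Thm 6 p. 193] -/
theorem coe_ratPointsThetaLiftCont_mem_adelicMpTheta
    (g : ((transportSp T hT).comp (mapHom (algebraMap F (AdeleRing (𝓞 F) F)))).range) :
    (ratPointsThetaLiftCont F ι T hT g : adelicMp F ι T) ∈ adelicMpTheta F ι T :=
  coe_ratThetaLiftContι_mem_adelicMpTheta F ι T hT _

/-- `Θ(ω(r_F h) Φ) = Θ(Φ)`. [cite: Weil1964, Chap. III n° 41 Thm 6 p. 193] -/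
theorem thetaDist_omega_ratPointsThetaLiftCont
    (g : ((transportSp T hT).comp (mapHom (algebraMap F (AdeleRing (𝓞 F) F)))).range) (Φ : piSchwartzBruhat F ι) :
    thetaDist F ι ((adelicMpCont.omega F ι T (ratPointsThetaLiftCont F ι T hT g) Φ : piSchwartzBruhat F ι) :
        (ι → AdeleRing (𝓞 F) F) → ℂ) = thetaDist F ι (Φ : (ι → AdeleRing (𝓞 F) F) → ℂ) :=
  thetaDist_omega_ratThetaLiftContι F ι T hT _ Φ

/-- **Uniqueness**: a Θ-fixing pair of `Mp_ψ(W_𝔸)` over a rational point `h` IS `r_F h`.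
[cite: Weil1964, Chap. III n° 40 p. 190] -/
theorem coe_ratPointsThetaLiftCont_eq
    {g : ((transportSp T hT).comp (mapHom (algebraMap F (AdeleRing (𝓞 F) F)))).range} {p : adelicMp F ι T}
    (hΘ : p ∈ adelicMpTheta F ι T) (hp : MpPsi.proj _ p = (g : symplecticGroup (polar (adelicForm F ι T)))) :
    (ratPointsThetaLiftCont F ι T hT g : adelicMp F ι T) = p :=
  coe_ratThetaLiftContι_eq F ι T hT hΘ (hp.trans (ratSpι_ratSpιRangeEquiv_symm F ι T hT g).symm)

end RatPoints

end Literature.NumberTheory.Weil1964
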